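import Literature.Analysis.FluidPDE.DivFreeDriftPositivityPropagation
import Literature.Analysis.FluidPDE.SpaceTimeRescaling
import HarnessLib

/-!
# Propagation of positivity with a bounded divergence-free drift — parabolic covariance
# (Nazarov–Ural'tseva 2011 / Lei–Ren–Tian 2025 Lemma 2.5 on an arbitrary cylinder `(t₀, t₀ + R²T) × B(x₀, R)`)

Topic `Literature/Analysis/FluidPDE` (family `ns`). Companion of `DivFreeDriftPositivityPropagation.lean`
(the named fact `NazarovUraltseva2011_positivity_propagation E`, typed on the UNIT cylinder `(0,T) × B(0,1)`)
and of `DivFreeDriftPositivityPropagationClassical.lean` (its classical `C²` corollary).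

Lei–Ren–Tian (arXiv:2501.08976, after Lemma 2.5, p. 7): "The exact choice of domains in Lemma 2.5 can be rather
arbitrary, as long as the relation `t̄ < T/2` is respected."  Every consumer (the `Γ`-oscillation argument of
LRT §4 pp. 11–12, run on shells `𝒟₁`, `𝒟₂` and along Harnack chains of balls avoiding the symmetry axis; the
route `AxisTwistDoor` of `NavierStokesRegularity`, where the classical version of this covariance is
`…Theorems.AxisTwistDoorAveragedConeLiouvillePositivityAffine`) needs the fact on TRANSLATED AND PARABOLICALLY
DILATED cylinders `(t₀, t₀ + R²T) × B(x₀, R)` with the SAME constant `β = β(E, A, δ, T, r)`: the drift bound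
becomes `‖b‖ ≤ A/R`, the occupied level set has measure `≥ δ Rⁿ` (`n = dim E`), the conclusion holds on
`(t₀ + R²T/2, t₀ + R²T) × B(x₀, rR)`.  This file DERIVES that covariant form from the unit-cylinder fact by the
parabolic change of variables `Φ(s, y) = (t₀ + R²s, x₀ + Ry)` of `SpaceTimeRescaling.lean`
(`V ↦ V ∘ Φ`, `b ↦ R • b ∘ Φ`, test functions pushed forward along `Φ⁻¹`; Lebesgue measure scales by
`(R²·Rⁿ)⁻¹`, time derivatives by `R²`, gradients by `R`, so every integrand of the weak formulation scales by the
common factor `R²`).  No new mathematics: [folklore] parabolic scaling, as in Escauriaza–Seregin–Šverák 2003 §3.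

Main declaration: `NazarovUraltseva2011_positivity_propagation.affine` — unit-cylinder fact ⇒ the covariant
statement on every cylinder `(t₀, t₀ + R²T) × B(x₀, R)` (stated in full in the theorem; no new named `Prop` is
introduced, so the tree's named-fact debt is unchanged).

For `E = ℝ³` the unit-cylinder fact is a theorem of the tree
(`Summit.NavierStokesRegularity.NavierStokesRegularity.Theorems.AveragedConeLiouville.NUPositivity.nazarovUraltseva2011_positivity_propagation_R3`,
Theorems-side), so the covariant form is unconditional there (instantiated Theorems-side; Literature cannot
import Summits).

## References

* A. I. Nazarov, N. N. Ural'tseva, *The Harnack inequality and related properties for solutions of elliptic and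
  parabolic equations with divergence-free lower-order coefficients*, Algebra i Analiz 23:1 (2011) 136–168 =
  St. Petersburg Math. J. 23 (2012) 93–115 = arXiv:1011.1888, §3 Cor. 3.2, Lemma 3.4, Cor. 3.3.
  [NazarovUraltseva2011HarnackDivFree]
* Z. Lei, X. Ren, G. Tian, *A geometric characterization of potential Navier–Stokes singularities*,
  arXiv:2501.08976 (2025), Lemma 2.5 and the sentence after it (p. 7). [LeiRenTian2025]
* L. Escauriaza, G. Seregin, V. Šverák, *`L_{3,∞}`-solutions of Navier–Stokes equations and backward
  uniqueness*, Russ. Math. Surveys 58:2 (2003), §3 (parabolic scaling). [EscauriazaSereginSverak2003]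
-/

noncomputable section

open MeasureTheory Set Function Metric Filter Topology

namespace Literature.Analysis.FluidPDE

section PositivityPropagationAffine

variable {E : Type*} [NormedAddCommGroup E] [InnerProductSpace ℝ E] [FiniteDimensional ℝ E]
  [MeasurableSpace E] [BorelSpace E]

/-! ### Elementary facts about the parabolic change of variables `Φ(s,y) = (t₀ + R²s, x₀ + Ry)` -/

omit [FiniteDimensional ℝ E] [MeasurableSpace E] [BorelSpace E] in
/-- The unit cylinder is the preimage of `(t₀, t₀ + R²T) × B(x₀, R)` under `Φ`. [folklore] -/
private theorem stAffine_preimage_unitCylinder {R : ℝ} (hR : 0 < R) (t₀ T : ℝ) (x₀ : E) :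
    stAffine (R ^ 2) R t₀ x₀ ⁻¹' (Ioo t₀ (t₀ + R ^ 2 * T) ×ˢ ball x₀ R) =
      Ioo (0 : ℝ) T ×ˢ ball (0 : E) 1 := by
  rw [stAffine_preimage_cylinder (by positivity) hR]
  congr 1
  · congr 1
    · simp
    · field_simp
      ring
  · rw [sub_self, smul_zero, div_self hR.ne']

omit [FiniteDimensional ℝ E] [MeasurableSpace E] [BorelSpace E] in
/-- `Φ` maps the unit cylinder into the big cylinder. [folklore] -/
private theorem stAffine_mem_cylinder {R : ℝ} (hR : 0 < R) {t₀ T : ℝ} {x₀ : E} {s : ℝ} {y : E}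
    (hs : s ∈ Ioo (0 : ℝ) T) (hy : y ∈ ball (0 : E) 1) :
    t₀ + R ^ 2 * s ∈ Ioo t₀ (t₀ + R ^ 2 * T) ∧ x₀ + R • y ∈ ball x₀ R := by
  have h : ((s, y) : ℝ × E) ∈ stAffine (R ^ 2) R t₀ x₀ ⁻¹' (Ioo t₀ (t₀ + R ^ 2 * T) ×ˢ ball x₀ R) := by
    rw [stAffine_preimage_unitCylinder hR]; exact mk_mem_prod hs hy
  simpa only [mem_preimage, stAffine_apply, mem_prod] using h

omit [FiniteDimensional ℝ E] [MeasurableSpace E] [BorelSpace E] in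
/-- The space–time affine map `Φ` is Lipschitz with constant `max |β| |γ|` (sup metric on `ℝ × E`). [folklore] -/
private theorem stAffine_lipschitzWith (β γ t₀ : ℝ) (x₀ : E) :
    LipschitzWith (max ‖β‖₊ ‖γ‖₊) (stAffine β γ t₀ x₀ : ℝ × E → ℝ × E) := by
  have h1 : LipschitzWith ‖β‖₊ (fun z : ℝ × E => t₀ + β * z.1) :=
    LipschitzWith.of_dist_le_mul fun z w => by
      rw [Real.dist_eq, add_sub_add_left_eq_sub, ← mul_sub, abs_mul, coe_nnnorm, Real.norm_eq_abs,
        ← Real.dist_eq]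
      gcongr
      calc dist z.1 w.1 ≤ max (dist z.1 w.1) (dist z.2 w.2) := le_max_left _ _
        _ = dist z w := Prod.dist_eq.symm
  have h2 : LipschitzWith ‖γ‖₊ (fun z : ℝ × E => x₀ + γ • z.2) :=
    LipschitzWith.of_dist_le_mul fun z w => by
      rw [dist_eq_norm, add_sub_add_left_eq_sub, ← smul_sub, norm_smul, coe_nnnorm, ← dist_eq_norm]
      gcongr
      calc dist z.2 w.2 ≤ max (dist z.1 w.1) (dist z.2 w.2) := le_max_right _ _
        _ = dist z w := Prod.dist_eq.symm
  exact h1.prodMk h2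

omit [FiniteDimensional ℝ E] [MeasurableSpace E] [BorelSpace E] in
/-- The pull-back of a test function along `Φ⁻¹` is supported in the big cylinder if the test function is
supported in the unit cylinder. [folklore] -/
private theorem tsupport_stPull_inv_subset {R : ℝ} (hR : 0 < R) {t₀ T : ℝ} {x₀ : E} {φ' : ℝ → E → ℝ}
    (hsupp : tsupport (uncurry φ') ⊆ Ioo (0 : ℝ) T ×ˢ ball (0 : E) 1) :
    tsupport (uncurry (stPull (R ^ 2)⁻¹ R⁻¹ (-((R ^ 2)⁻¹ * t₀)) (-(R⁻¹ • x₀)) φ')) ⊆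
      Ioo t₀ (t₀ + R ^ 2 * T) ×ˢ ball x₀ R := by
  have hR2 : (0 : ℝ) < R ^ 2 := by positivity
  rw [uncurry_stPull, ← stAffineHomeomorph_symm_eq hR2.ne' hR.ne', tsupport_comp_eq_preimage]
  intro z hz
  have h1 := hsupp hz
  rw [← stAffine_preimage_unitCylinder hR t₀ T x₀, mem_preimage, stAffine_apply_symm] at h1
  exact h1

/-- **Nazarov–Ural'tseva propagation of positivity on an arbitrary parabolic cylinder** (parabolically covariant
form of the named fact `NazarovUraltseva2011_positivity_propagation E` = Lei–Ren–Tian 2025 Lemma 2.5 with "the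
exact choice of domains in Lemma 2.5 can be rather arbitrary, as long as the relation `t̄ < T/2` is respected",
arXiv:2501.08976 p. 7; Nazarov–Ural'tseva 2011 Cor. 3.2 / Lemma 3.4 / Cor. 3.3 are themselves stated on arbitrary
cylinders `Q_R`).  ASSUMING the unit-cylinder fact for `E`: for `2 ≤ dim E` and all `A ≥ 0`, `δ > 0`, `T > 0`,
`0 < r < 1` there is `β > 0` (the unit-cylinder constant) such that for every centre `x₀`, initial time `t₀` and
radius `R > 0`: every jointly measurable drift `b` with `‖b(t,x)‖ ≤ A/R` on `(t₀, t₀ + R²T) × B(x₀, R)` and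
`∫∫ ⟪b, ∇ₓφ⟫ = 0` for all smooth `φ` compactly supported in that open cylinder, every `V` Lipschitz and
nonnegative on the cylinder which is a generalized supersolution of `∂ₜV − ΔV + b·∇V = 0` there (against every
nonnegative Lipschitz `η` vanishing for `‖x − x₀‖ ≥ ρR` and for `t ≤ t₀ + R²τ`, some `ρ < 1`, `τ > 0`), every
level `λ > 0` and time `t̄ ∈ (t₀, t₀ + R²T/3)` with `vol {x ∈ B(x₀,R) | λ ≤ V(t̄,x)} ≥ δ Rⁿ` (`n = dim E`) satisfy
`β λ ≤ V(t,x)` for `t ∈ (t₀ + R²T/2, t₀ + R²T)`, `x ∈ B(x₀, rR)`.  Proof: the parabolic change of variables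
`Φ(s,y) = (t₀ + R²s, x₀ + Ry)` of `SpaceTimeRescaling.lean` (`V ↦ V ∘ Φ`, `b ↦ R • b ∘ Φ`, test functions pushed
forward along `Φ⁻¹`; Lebesgue measure scales by `(R²Rⁿ)⁻¹`, `∂ₜ` by `R²`, `∇ₓ` by `R`, so every integrand of the
weak formulation scales by `R²`), as in Escauriaza–Seregin–Šverák 2003 §3.
[cite: LeiRenTian2025, Lemma 2.5 and remark after it (arXiv p.7)]
[cite: NazarovUraltseva2011HarnackDivFree, Cor 3.2 (arXiv p.10)] -/
theorem NazarovUraltseva2011_positivity_propagation.affine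
    (h : NazarovUraltseva2011_positivity_propagation E) (hE : 2 ≤ Module.finrank ℝ E)
    ⦃A δ T r : ℝ⦄ (hA : 0 ≤ A) (hδ : 0 < δ) (hT : 0 < T) (hr : 0 < r) (hr1 : r < 1) :
    ∃ β : ℝ, 0 < β ∧ ∀ ⦃x₀ : E⦄ ⦃t₀ R : ℝ⦄, 0 < R →
      ∀ ⦃b : ℝ → E → E⦄ ⦃V : ℝ → E → ℝ⦄ ⦃lam tbar : ℝ⦄,
      Measurable (uncurry b) →
      (∀ t ∈ Ioo t₀ (t₀ + R ^ 2 * T), ∀ x ∈ ball x₀ R, ‖b t x‖ ≤ A / R) →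
      (∀ φ : ℝ → E → ℝ, ContDiff ℝ (⊤ : ℕ∞) (uncurry φ) → HasCompactSupport (uncurry φ) →
        tsupport (uncurry φ) ⊆ Ioo t₀ (t₀ + R ^ 2 * T) ×ˢ ball x₀ R →
        ∫ p in Ioo t₀ (t₀ + R ^ 2 * T) ×ˢ ball x₀ R,
          inner ℝ (b p.1 p.2) (gradient (φ p.1) p.2) = 0) →
      (∃ L, LipschitzOnWith L (uncurry V) (Ioo t₀ (t₀ + R ^ 2 * T) ×ˢ ball x₀ R)) →
      (∀ t ∈ Ioo t₀ (t₀ + R ^ 2 * T), ∀ x ∈ ball x₀ R, 0 ≤ V t x) →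
      (∀ η : ℝ → E → ℝ, (∃ K, LipschitzWith K (uncurry η)) → (∀ t x, 0 ≤ η t x) →
        (∃ ρ τ : ℝ, ρ < 1 ∧ 0 < τ ∧ ∀ t x, (ρ * R ≤ ‖x - x₀‖ ∨ t ≤ t₀ + R ^ 2 * τ) → η t x = 0) →
        0 ≤ ∫ p in Ioo t₀ (t₀ + R ^ 2 * T) ×ˢ ball x₀ R,
          (deriv (fun s => V s p.2) p.1 * η p.1 p.2 +
            inner ℝ (gradient (V p.1) p.2) (gradient (η p.1) p.2) +
            inner ℝ (b p.1 p.2) (gradient (V p.1) p.2) * η p.1 p.2)) →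
      0 < lam → tbar ∈ Ioo t₀ (t₀ + R ^ 2 * T / 3) →
      ENNReal.ofReal (δ * R ^ Module.finrank ℝ E) ≤ volume {x ∈ ball x₀ R | lam ≤ V tbar x} →
      ∀ ⦃t : ℝ⦄ ⦃x : E⦄, t ∈ Ioo (t₀ + R ^ 2 * T / 2) (t₀ + R ^ 2 * T) → x ∈ ball x₀ (r * R) →
        β * lam ≤ V t x := by
  obtain ⟨β, hβ, H⟩ := h hE hA hδ hT hr hr1
  refine ⟨β, hβ, ?_⟩
  intro x₀ t₀ R hR b V lam tbar hbm hbA hdiv hVlip hV0 hsup hlam htbar hmeas t x ht hx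
  have hR2 : (0 : ℝ) < R ^ 2 := by positivity
  have hRn : (0 : ℝ) < R ^ Module.finrank ℝ E := by positivity
  -- the big cylinder `C`, the unit cylinder `C₁ = Φ⁻¹ C`
  set C : Set (ℝ × E) := Ioo t₀ (t₀ + R ^ 2 * T) ×ˢ ball x₀ R with hCdef
  have hpre : stAffine (R ^ 2) R t₀ x₀ ⁻¹' C = Ioo (0 : ℝ) T ×ˢ ball (0 : E) 1 :=
    stAffine_preimage_unitCylinder hR t₀ T x₀
  have hmaps : MapsTo (stAffine (R ^ 2) R t₀ x₀) (Ioo (0 : ℝ) T ×ˢ ball (0 : E) 1) C := by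
    intro z hz
    rw [← hpre] at hz
    exact hz
  -- rescaled solution and drift on the unit cylinder
  set V' : ℝ → E → ℝ := stPull (R ^ 2) R t₀ x₀ V with hV'def
  set b' : ℝ → E → E := fun s y => R • b (t₀ + R ^ 2 * s) (x₀ + R • y) with hb'def
  -- (1) measurability of the rescaled drift
  have g1 : Measurable (uncurry b') := by
    change Measurable (fun z : ℝ × E => R • uncurry b (stAffine (R ^ 2) R t₀ x₀ z))
    exact (hbm.comp (measurable_stAffine _ _ _ _)).const_smul R
  -- (2) the drift bound `‖b'‖ ≤ A`
  have g2 : ∀ s ∈ Ioo (0 : ℝ) T, ∀ y ∈ ball (0 : E) 1, ‖b' s y‖ ≤ A := by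
    intro s hs y hy
    obtain ⟨hs', hy'⟩ := stAffine_mem_cylinder hR (t₀ := t₀) (x₀ := x₀) hs hy
    have hb := hbA _ hs' _ hy'
    rw [hb'def, norm_smul, Real.norm_of_nonneg hR.le]
    calc R * ‖b (t₀ + R ^ 2 * s) (x₀ + R • y)‖ ≤ R * (A / R) := by gcongr
      _ = A := by field_simp
  -- (3) the rescaled drift is divergence free in `𝒟'`
  have g3 : ∀ φ : ℝ → E → ℝ, ContDiff ℝ (⊤ : ℕ∞) (uncurry φ) → HasCompactSupport (uncurry φ) →
      tsupport (uncurry φ) ⊆ Ioo (0 : ℝ) T ×ˢ ball (0 : E) 1 →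
      ∫ p in Ioo (0 : ℝ) T ×ˢ ball (0 : E) 1, inner ℝ (b' p.1 p.2) (gradient (φ p.1) p.2) = 0 := by
    intro φ' hφ' hφ'c hφ'supp
    -- push the test function forward along `Φ⁻¹`
    set φ : ℝ → E → ℝ := stPull (R ^ 2)⁻¹ R⁻¹ (-((R ^ 2)⁻¹ * t₀)) (-(R⁻¹ • x₀)) φ' with hφdef
    have hφeq : stPull (R ^ 2) R t₀ x₀ φ = φ' := stPull_stPull_symm hR2.ne' hR.ne' t₀ x₀ φ'
    have hunc : uncurry φ = uncurry φ' ∘ ⇑(stAffineHomeomorph hR2.ne' hR.ne' t₀ x₀).symm := by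
      rw [hφdef, uncurry_stPull, ← stAffineHomeomorph_symm_eq hR2.ne' hR.ne']
    have hφs : ContDiff ℝ (⊤ : ℕ∞) (uncurry φ) := by
      rw [hφdef, uncurry_stPull]
      exact hφ'.comp (contDiff_stAffine _ _ _ _)
    have hφc : HasCompactSupport (uncurry φ) := by
      rw [hunc]
      exact hφ'c.comp_homeomorph _
    have hφsupp : tsupport (uncurry φ) ⊆ C := tsupport_stPull_inv_subset hR hφ'supp
    have h0 := hdiv φ hφs hφc hφsupp
    -- the unit-cylinder integrand is `R² ⟪b, ∇φ⟫ ∘ Φ`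
    set F : ℝ × E → ℝ := fun q => R ^ 2 * inner ℝ (b q.1 q.2) (gradient (φ q.1) q.2) with hFdef
    have hfun : (fun p : ℝ × E => inner ℝ (b' p.1 p.2) (gradient (φ' p.1) p.2)) =
        fun p => F (stAffine (R ^ 2) R t₀ x₀ p) := by
      funext p
      rw [← hφeq, gradient_stPull, hb'def, hFdef]
      simp only [stAffine, real_inner_smul_left, real_inner_smul_right]
      ring
    have hF : ∫ q in C, F q = 0 := by
      rw [hFdef, integral_const_mul, h0, mul_zero]
    rw [← hpre, hfun, setIntegral_preimage_comp_stAffine hR2 hR t₀ x₀ F C, hF, smul_zero]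
  -- (4) the rescaled solution is Lipschitz on the unit cylinder
  have g4 : ∃ L, LipschitzOnWith L (uncurry V') (Ioo (0 : ℝ) T ×ˢ ball (0 : E) 1) := by
    obtain ⟨L, hL⟩ := hVlip
    refine ⟨L * max ‖R ^ 2‖₊ ‖R‖₊, ?_⟩
    rw [hV'def, uncurry_stPull]
    exact hL.comp (stAffine_lipschitzWith _ _ _ _).lipschitzOnWith hmaps
  -- (5) nonnegativity
  have g5 : ∀ s ∈ Ioo (0 : ℝ) T, ∀ y ∈ ball (0 : E) 1, 0 ≤ V' s y := by
    intro s hs y hy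
    obtain ⟨hs', hy'⟩ := stAffine_mem_cylinder hR (t₀ := t₀) (x₀ := x₀) hs hy
    exact hV0 _ hs' _ hy'
  -- (6) the generalized supersolution inequality transports (every term scales by `R²`)
  have g6 : ∀ η : ℝ → E → ℝ, (∃ K, LipschitzWith K (uncurry η)) → (∀ t x, 0 ≤ η t x) →
      (∃ ρ τ : ℝ, ρ < 1 ∧ 0 < τ ∧ ∀ t x, (ρ ≤ ‖x‖ ∨ t ≤ τ) → η t x = 0) →
      0 ≤ ∫ p in Ioo (0 : ℝ) T ×ˢ ball (0 : E) 1,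
        (deriv (fun s => V' s p.2) p.1 * η p.1 p.2 +
          inner ℝ (gradient (V' p.1) p.2) (gradient (η p.1) p.2) +
          inner ℝ (b' p.1 p.2) (gradient (V' p.1) p.2) * η p.1 p.2) := by
    rintro η' ⟨K, hK⟩ hη'0 ⟨ρ, τ, hρ, hτ, hvan⟩
    set η : ℝ → E → ℝ := stPull (R ^ 2)⁻¹ R⁻¹ (-((R ^ 2)⁻¹ * t₀)) (-(R⁻¹ • x₀)) η' with hηdef
    have hηeq : stPull (R ^ 2) R t₀ x₀ η = η' := stPull_stPull_symm hR2.ne' hR.ne' t₀ x₀ η'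
    have hηK : ∃ K', LipschitzWith K' (uncurry η) := by
      refine ⟨K * max ‖(R ^ 2)⁻¹‖₊ ‖R⁻¹‖₊, ?_⟩
      rw [hηdef, uncurry_stPull]
      exact hK.comp (stAffine_lipschitzWith _ _ _ _)
    have hη0 : ∀ t x, 0 ≤ η t x := fun t x => hη'0 _ _
    have hηvan : ∃ ρ' τ' : ℝ, ρ' < 1 ∧ 0 < τ' ∧
        ∀ t x, (ρ' * R ≤ ‖x - x₀‖ ∨ t ≤ t₀ + R ^ 2 * τ') → η t x = 0 := by
      refine ⟨ρ, τ, hρ, hτ, fun t x hx => ?_⟩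
      rw [hηdef, stPull_apply]
      apply hvan
      rcases hx with hx | hx
      · left
        have hx' : -(R⁻¹ • x₀) + R⁻¹ • x = R⁻¹ • (x - x₀) := by rw [smul_sub]; abel
        rw [hx', norm_smul, Real.norm_of_nonneg (inv_nonneg.2 hR.le)]
        calc ρ = R⁻¹ * (ρ * R) := by field_simp
          _ ≤ R⁻¹ * ‖x - x₀‖ := by gcongr
      · right
        have ht' : -((R ^ 2)⁻¹ * t₀) + (R ^ 2)⁻¹ * t = (R ^ 2)⁻¹ * (t - t₀) := by ring
        rw [ht']
        calc (R ^ 2)⁻¹ * (t - t₀) ≤ (R ^ 2)⁻¹ * (R ^ 2 * τ) := by gcongr; linarith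
          _ = τ := by field_simp
    have h1 := hsup η hηK hη0 hηvan
    -- the unit-cylinder integrand is `R² · (integrand) ∘ Φ`
    set G : ℝ × E → ℝ := fun q => R ^ 2 *
      (deriv (fun s => V s q.2) q.1 * η q.1 q.2 +
        inner ℝ (gradient (V q.1) q.2) (gradient (η q.1) q.2) +
        inner ℝ (b q.1 q.2) (gradient (V q.1) q.2) * η q.1 q.2) with hGdef
    have hfun : (fun p : ℝ × E =>
        deriv (fun s => V' s p.2) p.1 * η' p.1 p.2 +
          inner ℝ (gradient (V' p.1) p.2) (gradient (η' p.1) p.2) +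
          inner ℝ (b' p.1 p.2) (gradient (V' p.1) p.2) * η' p.1 p.2) =
        fun p => G (stAffine (R ^ 2) R t₀ x₀ p) := by
      funext p
      have hd : deriv (fun s => V' s p.2) p.1 =
          R ^ 2 * deriv (fun s => V s (x₀ + R • p.2)) (t₀ + R ^ 2 * p.1) := by
        have := timeDeriv_stPull (R ^ 2) R t₀ x₀ V p.1 p.2
        simpa only [timeDeriv_apply, smul_eq_mul] using this
      have hηp : η' p.1 p.2 = η (t₀ + R ^ 2 * p.1) (x₀ + R • p.2) := by
        rw [← hηeq, stPull_apply]
      have hgV : gradient (V' p.1) p.2 = R • gradient (V (t₀ + R ^ 2 * p.1)) (x₀ + R • p.2) := by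
        rw [hV'def, gradient_stPull]
      have hgη : gradient (η' p.1) p.2 = R • gradient (η (t₀ + R ^ 2 * p.1)) (x₀ + R • p.2) := by
        rw [← hηeq, gradient_stPull]
      rw [hd, hηp, hgV, hgη, hb'def, hGdef]
      simp only [stAffine, real_inner_smul_left, real_inner_smul_right]
      ring
    have hG : 0 ≤ ∫ q in C, G q := by
      rw [hGdef, integral_const_mul]
      exact mul_nonneg hR2.le h1
    rw [← hpre, hfun, setIntegral_preimage_comp_stAffine hR2 hR t₀ x₀ G C, smul_eq_mul]
    exact mul_nonneg (by positivity) hG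
  -- (7) the occupation time in unit coordinates
  have g7 : (tbar - t₀) / R ^ 2 ∈ Ioo (0 : ℝ) (T / 3) := by
    obtain ⟨h₁, h₂⟩ := htbar
    refine ⟨div_pos (by linarith) hR2, ?_⟩
    rw [div_lt_iff₀ hR2]
    linarith
  -- (8) the occupied level set in unit coordinates has measure `≥ δ`
  have g8 : ENNReal.ofReal δ ≤
      volume {y ∈ ball (0 : E) 1 | lam ≤ V' ((tbar - t₀) / R ^ 2) y} := by
    set S : Set E := {x ∈ ball x₀ R | lam ≤ V tbar x} with hSdef
    have htb : t₀ + R ^ 2 * ((tbar - t₀) / R ^ 2) = tbar := by field_simp; ring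
    have hball : (fun y : E => x₀ + R • y) ⁻¹' ball x₀ R = ball (0 : E) 1 := by
      rw [space_affine_preimage_ball hR, sub_self, smul_zero, div_self hR.ne']
    have hset : {y ∈ ball (0 : E) 1 | lam ≤ V' ((tbar - t₀) / R ^ 2) y} =
        (fun y : E => x₀ + R • y) ⁻¹' S := by
      ext y
      rw [← hball]
      simp only [mem_setOf_eq, mem_preimage, hSdef, hV'def, stPull_apply, htb]
    have hdecomp : (fun y : E => x₀ + R • y) ⁻¹' S = (fun y : E => R • y) ⁻¹' ((fun w : E => x₀ + w) ⁻¹' S) :=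
      rfl
    rw [hset, hdecomp, Measure.addHaar_preimage_smul volume hR.ne', measure_preimage_add,
      abs_of_pos (inv_pos.2 hRn)]
    calc ENNReal.ofReal δ = ENNReal.ofReal ((R ^ Module.finrank ℝ E)⁻¹ * (δ * R ^ Module.finrank ℝ E)) := by
          congr 1; field_simp
      _ = ENNReal.ofReal (R ^ Module.finrank ℝ E)⁻¹ * ENNReal.ofReal (δ * R ^ Module.finrank ℝ E) :=
          ENNReal.ofReal_mul (inv_nonneg.2 hRn.le)
      _ ≤ ENNReal.ofReal (R ^ Module.finrank ℝ E)⁻¹ * volume S := by gcongr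
  -- (9)–(10) the evaluation point in unit coordinates
  have g9 : (t - t₀) / R ^ 2 ∈ Ioo (T / 2) T := by
    obtain ⟨h₁, h₂⟩ := ht
    constructor
    · rw [lt_div_iff₀ hR2]; linarith
    · rw [div_lt_iff₀ hR2]; linarith
  have g10 : R⁻¹ • (x - x₀) ∈ ball (0 : E) r := by
    rw [mem_ball_zero_iff, norm_smul, Real.norm_of_nonneg (inv_nonneg.2 hR.le)]
    rw [mem_ball, dist_eq_norm] at hx
    calc R⁻¹ * ‖x - x₀‖ < R⁻¹ * (r * R) := by gcongr
      _ = r := by field_simp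
  have key := @H b' V' lam ((tbar - t₀) / R ^ 2) g1 g2 g3 g4 g5 g6 hlam g7 g8 ((t - t₀) / R ^ 2)
    (R⁻¹ • (x - x₀)) g9 g10
  have hts : t₀ + R ^ 2 * ((t - t₀) / R ^ 2) = t := by field_simp; ring
  have hxs : x₀ + R • (R⁻¹ • (x - x₀)) = x := by
    rw [smul_smul, mul_inv_cancel₀ hR.ne', one_smul]; abel
  simpa only [hV'def, stPull_apply, hts, hxs] using key

end PositivityPropagationAffine

end Literature.Analysis.FluidPDE

end
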